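import Literature.IUT.LogThetaLattice.PacketLogVolumesHaarModelRelLocal
import HarnessLib

/-!
# [IUTchIII] Proposition 3.9 (i)/(iii), relative case `K ⊋ F_mod`: the ARCHIMEDEAN summands `K_w`, `w | v`,
# as `F_mod`-data — modulus `|f|_w = |f|_v` and the weight cancellation `[K_w:ℝ]/([K_w:F_v]·[F:ℚ]) = [F_v:ℝ]/[F:ℚ]`
# (abc-iut cell, layer L6; row REL39, part R1-arch)

S. Mochizuki, *Inter-universal Teichmüller theory III*, kurims manuscript (May 2020), §3, Proposition 3.9 (i)
p. 116 (archimedean `v_ℚ`): "the sum of the radial log-volumes on each of the direct summand complex archimedean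
fields of `𝓘^ℚ(^α𝓕_{v_ℚ})` — cf. the direct sum decompositions of Proposition 3.1, (i), together with the discussion
of normalized weights in Remark 3.1.1, (ii), (iii), (iv) — determines [cf. [AbsTopIII], Proposition 5.7, (ii)]
log-volumes … Here, we assume that these log-volumes are normalized so that multiplication of an element of
"`𝕄(−)`" by `e = 2.71828...` corresponds to adding the quantity `1 = log(e) ∈ ℝ`; we shall refer to this
normalization as the packet-normalization." Remark 3.1.1 (ii), p. 94: "the normalized weight
`1/([K_v : (F_mod)_v]·(Σ_{𝕍_mod ∋ w | v_ℚ} [(F_mod)_w : ℚ_{v_ℚ}]))`" [claim: Mochizuki2012, status: disputed].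

WHAT THIS FILE ADDS (part R1-arch of row REL39, plan/L6 §F v1.19c; the nonarchimedean part R1-nonarch is
abc-iut-L6-t5's `PacketLogVolumesHaarModelRelLocal.lean`, whose definitions `relPlaceDatum F K`,
`relLocalDegree F K`, `relHaarWeight F K` this file CONSUMES BY NAME and never re-types). For an extension of
number fields `F = F_mod ⊆ K` and an ARCHIMEDEAN place `w` of `K` over `v = w|_F` (Mathlib
`w.comap (algebraMap F K)`), the relative summand is the complex archimedean field `ℂ` with the RADIAL volume of
[AbsTopIII] Prop. 5.7 (ii) reached through `σ_w` (abc-iut-L6-d3's `archDatum K w`), `f ∈ F` acting through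
`F ↪ K ↪ ℂ`:
* (a) `modulus_relPlaceDatum_inl`: the modulus of `f ∈ F` on `K_w` is `|σ_w(f)| = |f|_w = |f|_v` — NO exponent at
  an archimedean place (Mathlib's `w f = ‖σ_w f‖` is the un-squared absolute value at complex `w` too; Mathlib
  `InfinitePlace.comap_apply`), so the relative summand has the modulus of the ABSOLUTE summand of `F` at `v`
  (d3's `placeDatum F (inl v)`);
* (b) `relHaarWeight_inl_eq`: L6-t5's archimedean weight `[K_w:ℝ]/([K_w:F_v]·[F:ℚ])` — Remark 3.1.1 (ii)'s
  `1/([K_w:F_v]·Σ_{w'|∞}[F_{w'}:ℝ])` times the packet-normalisation factor `[K_w:ℝ]` of Prop. 3.9 (i) p. 116 —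
  EQUALS d3's absolute weight `[F_v:ℝ]/[F:ℚ]` (`haarWeight F (inl v)`), because `[K_w:ℝ] = [K_w:F_v]·[F_v:ℝ]`
  (campaign-S `pullbackWeight_mul_mult_comap`: `m_w·mult(v) = mult(w)`); restated `relLocalDegree_inl_mul_mult_comap`;
* (a)+(b) `relHaarWeight_mul_log_modulus_inl` (and the `Place.below` form `…_inl'`): the weighted archimedean
  term of the relative model at `w` IS the weighted archimedean term of the absolute model of `F` at `v` —
  the archimedean half of "the exponent/degree `[K_v:(F_mod)_v]` cancels the factor `[K_v:(F_mod)_v]^{-1}` of the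
  printed weight" (L6-t5's `relHaarWeight_mul_log_modulus_inr` is the finite half); the assembly over a section
  `𝕍 ⥲ 𝕍_mod` and the product formula are part R2 (abc-iut-w5-d004, `PacketLogVolumesHaarModelRelative.lean`).

HONEST SCOPE. The archimedean summand is `ℂ` with the radial volume at EVERY archimedean `w` (faithful for the
totally complex `K` of [IUTchI] Def. 3.1 (b); a real `K_w = ℝ ⊂ ℂ` is still embedded in `ℂ`), as in d3's absolute
file. Classical mathematics (absolute values in extensions); nothing here constructs `(†𝓕⊛_mod)_α`, asserts anything
about [IUTchIII] Cor. 3.12, or takes a side; typed ≠ endorsed. Proof-only (no definition).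
-/

noncomputable section

namespace Literature.IUT.LogThetaLattice

open Literature.IUT.LogVolume NumberField IsDedekindDomain

variable (F K : Type) [Field F] [NumberField F] [Field K] [NumberField K] [Algebra F K]

/-! ### (a) The modulus at an archimedean place: `|f|_w = |f|_v` -/

/-- **(a) `|f|_{K_w} = |f|_{F_v}` for `w | v` archimedean**: the modulus of `f ∈ F` on the relative summand at `w`
(`|σ_w(f)| = w (algebraMap F K f)`, abc-iut-L6-t5's `relPlaceDatum_modulus_inl`) is the modulus of the absolute
summand of `F` at `v = w|_F` (`v f`, abc-iut-L6-d3's `archDatum_modulus`), by Mathlib's `InfinitePlace.comap_apply`.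
[claim: Mochizuki2012, status: disputed] -/
theorem modulus_relPlaceDatum_inl (w : InfinitePlace K) (f : F) :
    (relPlaceDatum F K (Sum.inl w)).modulus f =
      (placeDatum F (Sum.inl (w.comap (algebraMap F K)))).modulus f := by
  rw [relPlaceDatum_modulus_inl, placeDatum_inl, archDatum_modulus, InfinitePlace.comap_apply]

/-- The same in logarithms: `log|f|_{K_w} = log|f|_{F_v}` (the archimedean companion of L6-t5's
`log_modulus_relPlaceDatum_inr`, where the exponent `[K_w:F_v]` appears; at an archimedean place Mathlib's
normalisation `w f = ‖σ_w f‖` carries no exponent and the local degree enters only through the weight).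
[claim: Mochizuki2012, status: disputed] -/
theorem log_modulus_relPlaceDatum_inl (w : InfinitePlace K) (f : F) :
    Real.log ((relPlaceDatum F K (Sum.inl w)).modulus f) =
      Real.log ((placeDatum F (Sum.inl (w.comap (algebraMap F K)))).modulus f) := by
  rw [modulus_relPlaceDatum_inl]

/-! ### (b) The weight at an archimedean place: `[K_w:ℝ]/([K_w:F_v]·[F:ℚ]) = [F_v:ℝ]/[F:ℚ]` -/

omit [NumberField F] [NumberField K] in
/-- `[K_w : ℝ] = [K_w : F_v]·[F_v : ℝ]` with L6-t5's `relLocalDegree` for `[K_w:F_v] = m_w ∈ {1,2}` (campaign-S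
`pullbackWeight_mul_mult_comap`). [claim: Mochizuki2012, status: disputed] -/
theorem relLocalDegree_inl_mul_mult_comap (w : InfinitePlace K) :
    relLocalDegree F K (Sum.inl w) * (w.comap (algebraMap F K)).mult = w.mult := by
  rw [relLocalDegree_inl]
  exact pullbackWeight_mul_mult_comap F K w

/-- **(b) the archimedean weight of the relative model IS the absolute weight of `F` at the place below**:
`[K_w:ℝ]/([K_w:F_v]·[F:ℚ]) = [F_v:ℝ]/[F:ℚ]`, i.e. L6-t5's `relHaarWeight F K (inl w)` = abc-iut-L6-d3's
`haarWeight F (inl v)`, `v = w|_F` — Remark 3.1.1 (ii)'s factor `[K_v:(F_mod)_v]^{-1}` cancels against the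
packet-normalisation factor `[K_w:ℝ] = [K_w:F_v]·[F_v:ℝ]` of Prop. 3.9 (i) p. 116. [claim: Mochizuki2012, status: disputed] -/
theorem relHaarWeight_inl_eq (w : InfinitePlace K) :
    relHaarWeight F K (Sum.inl w) = haarWeight F (Sum.inl (w.comap (algebraMap F K))) := by
  have hm : (0 : ℝ) < relLocalDegree F K (Sum.inl w) := by exact_mod_cast relLocalDegree_pos F K (Sum.inl w)
  have hd : (0 : ℝ) < Module.finrank ℚ F := FinDivisor.finrank_pos (F := F)
  have key : (relLocalDegree F K (Sum.inl w) : ℝ) * ((w.comap (algebraMap F K)).mult : ℝ) = (w.mult : ℝ) := by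
    exact_mod_cast relLocalDegree_inl_mul_mult_comap F K w
  rw [relHaarWeight_inl, haarWeight_inl, ← key]
  field_simp

/-- The archimedean relative weight, evaluated: `relHaarWeight F K (inl w) = [F_v:ℝ]/[F:ℚ]` with `v = w|_F`.
[claim: Mochizuki2012, status: disputed] -/
theorem relHaarWeight_inl_eq_mult_div (w : InfinitePlace K) :
    relHaarWeight F K (Sum.inl w) = ((w.comap (algebraMap F K)).mult : ℝ) / Module.finrank ℚ F := by
  rw [relHaarWeight_inl_eq, haarWeight_inl]

/-- **Packet-normalisation bookkeeping at `∞` along a fibre**: summing the relative archimedean weights over ONE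
place `w` of `K` above each archimedean place `v` of `F` (any choice `w = s v` with `w|_F = v`) gives
`Σ_v [F_v:ℝ]/[F:ℚ] = 1` (d3's `sum_haarWeight_arch`) — the weights of the complex summands of the archimedean
packet of a section `𝕍 ⥲ 𝕍_mod` sum to `1`, so "`×e ↦ +log e`" (Prop. 3.9 (i) p. 116).
[claim: Mochizuki2012, status: disputed] -/
theorem sum_relHaarWeight_inl_section (s : InfinitePlace F → InfinitePlace K)
    (hs : ∀ v, (s v).comap (algebraMap F K) = v) :
    ∑ v : InfinitePlace F, relHaarWeight F K (Sum.inl (s v)) = 1 := by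
  simp only [relHaarWeight_inl_eq, hs]
  exact sum_haarWeight_arch F

/-! ### (a)+(b): the weighted archimedean term does not depend on `K` -/

/-- **The weighted archimedean term of the relative model at `w` IS the weighted archimedean term of the absolute
model of `F` at `v = w|_F`**: `relHaarWeight(w)·log|f|_{K_w} = haarWeight_F(v)·log|f|_{F_v}` for `f ∈ F^×` — the
archimedean half of the cancellation that makes the relative product-formula sum equal to the absolute one
(finite half: abc-iut-L6-t5's `relHaarWeight_mul_log_modulus_inr`; assembly: part R2).
[claim: Mochizuki2012, status: disputed] -/
theorem relHaarWeight_mul_log_modulus_inl (w : InfinitePlace K) (f : Fˣ) :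
    relHaarWeight F K (Sum.inl w) * Real.log ((relPlaceDatum F K (Sum.inl w)).modulus (f : F)) =
      haarWeight F (Sum.inl (w.comap (algebraMap F K))) *
        Real.log ((placeDatum F (Sum.inl (w.comap (algebraMap F K)))).modulus (f : F)) := by
  rw [relHaarWeight_inl_eq, modulus_relPlaceDatum_inl]

/-- The same with the place below written as campaign-S `Place.below F K (inl w) = inl (w|_F)` (the form the
assembly R2 sums over). [claim: Mochizuki2012, status: disputed] -/
theorem relHaarWeight_mul_log_modulus_inl' (w : InfinitePlace K) (f : Fˣ) :
    relHaarWeight F K (Sum.inl w) * Real.log ((relPlaceDatum F K (Sum.inl w)).modulus (f : F)) =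
      haarWeight F (Place.below F K (Sum.inl w)) *
        Real.log ((placeDatum F (Place.below F K (Sum.inl w))).modulus (f : F)) :=
  relHaarWeight_mul_log_modulus_inl F K w f

/-- In particular the archimedean relative term is `([F_v:ℝ]/[F:ℚ])·log|f|_v` (the printed normalized
contribution of `v` to the product formula, archimedean sign "addition … of `log(p_{v_ℚ})`", Remark 3.1.1 (ii)).
[claim: Mochizuki2012, status: disputed] -/
theorem relHaarWeight_mul_log_modulus_inl_eq (w : InfinitePlace K) (f : Fˣ) :
    relHaarWeight F K (Sum.inl w) * Real.log ((relPlaceDatum F K (Sum.inl w)).modulus (f : F)) =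
      ((w.comap (algebraMap F K)).mult : ℝ) / Module.finrank ℚ F *
        Real.log ((w.comap (algebraMap F K)) (f : F)) := by
  rw [relHaarWeight_mul_log_modulus_inl, haarWeight_inl, placeDatum_inl, archDatum_modulus]

/-- **Log-volumes move by `log|c|` under an archimedean unit**: on the relative summand at an archimedean `w`,
multiplication by `f ∈ F^×` adds `log|f|_v` to the radial log-volume of every admissible region ([AbsTopIII]
Prop. 5.7 (ii)(b) via d3's `PlaceHaarDatum.logVol_actAdm`, with (a)). [claim: Mochizuki2012, status: disputed] -/
theorem logVol_actAdm_relPlaceDatum_inl (w : InfinitePlace K) (f : Fˣ)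
    (T : (relPlaceDatum F K (Sum.inl w)).Adm) :
    (relPlaceDatum F K (Sum.inl w)).logVol ((relPlaceDatum F K (Sum.inl w)).actAdm f T).1 =
      (relPlaceDatum F K (Sum.inl w)).logVol T.1 + Real.log ((w.comap (algebraMap F K)) (f : F)) := by
  rw [PlaceHaarDatum.logVol_actAdm, modulus_relPlaceDatum_inl, placeDatum_inl, archDatum_modulus]

end Literature.IUT.LogThetaLattice

end
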